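import Literature.Computability.MetaComplexity.RefutationCNFUpperDefs
import Literature.Computability.MetaComplexity.RefutationCNFUpperAxioms
import Literature.Computability.MetaComplexity.ResolutionStepLists
import HarnessLib

/-!
# Pudlák's refutation of `RREF(F,s)`: every clause is a correct step

For each clause of the refutation list of `RefutationCNFUpperDefs.lean` we verify the resolution
step deriving it [Atserias–Müller 2020, proof of Lemma 11]: it is a weakening of an axiom of
`RREF(F,s)` (`RefutationCNFUpperAxioms.lean`) or of the resolvent of two clauses derived earlier
(`DerivStep` of `ResolutionStepLists.lean`), and we assemble the blocks into `StepList`s: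
`stepList_lineBlock` (the block of line `u` is a step list given `True(v)` for all `v < u`) and
`stepList_lastBlock`.

Conventions: `X` is the variable list (`n = X.length`), `F` the CNF (`m = F.length`), `s` the
number of lines, `α : ℕ → Bool` the assignment (`α i` = value of `X[i]`); the hypothesis
`hT` of the `A₀`-steps says that every clause `F[j]` has a literal `l` with `X.idxOf l.1 < n` and
`α (X.idxOf l.1) = l.2` (obtained in `RefutationCNFUpper.lean` from a satisfying assignment and
`X ⊇ vars F`) — "choose for every `j ∈ [m]` some `i_j ∈ [n]` such that `X_{i_j}^{(α(X_{i_j}))}`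
appears in `C_j`" [AM20, proof of Lemma 11].

## References

* A. Atserias, M. Müller, *Automating Resolution is NP-hard*, J. ACM 67(5) (2020), Art. 31;
  arXiv:1904.02991, §5, proof of Lemma 11.
-/

namespace Literature.Computability.MetaComplexity

open _root_.Computability Complexity

namespace RefCNF

namespace Pudlak

/-! ### Two combinatorial helpers for the chains -/

/-- Peeling the first index off an `Ico`-indexed disjunction. [folklore] -/
theorem image_Ico_subset_insert {β : Type*} [DecidableEq β] (f : ℕ → β) (k N : ℕ) :
    (Finset.Ico k N).image f ⊆ insert (f k) ((Finset.Ico (k + 1) N).image f) := by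
  intro x hx
  obtain ⟨j, hj, rfl⟩ := Finset.mem_image.1 hx
  rw [Finset.mem_Ico] at hj
  by_cases hjk : j = k
  · subst hjk; exact Finset.mem_insert_self _ _
  · exact Finset.mem_insert_of_mem
      (Finset.mem_image.2 ⟨j, Finset.mem_Ico.2 ⟨by omega, hj.2⟩, rfl⟩)

/-- Peeling the first index off a filtered `Ico`-indexed disjunction. [folklore] -/
theorem image_filter_Ico_subset_insert {β : Type*} [DecidableEq β] (f : ℕ → β) (k N i : ℕ) :
    ((Finset.Ico k N).filter fun i' => i' ≠ i).image f ⊆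
      insert (f k) (((Finset.Ico (k + 1) N).filter fun i' => i' ≠ i).image f) := by
  intro x hx
  obtain ⟨j, hj, rfl⟩ := Finset.mem_image.1 hx
  rw [Finset.mem_filter, Finset.mem_Ico] at hj
  by_cases hjk : j = k
  · subst hjk; exact Finset.mem_insert_self _ _
  · exact Finset.mem_insert_of_mem
      (Finset.mem_image.2 ⟨j, Finset.mem_filter.2 ⟨Finset.mem_Ico.2 ⟨by omega, hj.1.2⟩, hj.2⟩, rfl⟩)

variable {X : List ℕ} {F : CNF ℕ} {s : ℕ} {α : ℕ → Bool} {A : Set (Finset (Literal RefVar))}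

/-! ### The clauses `A₀(j,u)` and the `iCl`-chain -/

/-- `A₀(j,u)` is a weakening of the clause (A19) for the true literal of `C_j`.
[cite: AtseriasMuller2020, proof of Lemma 11 ("A₀(j,u) is a weakening of this")] -/
theorem derivStep_axCl (hA : clauseSet (rref X F s) ⊆ A)
    (hT : ∀ j, ∀ hj : j < F.length, ∃ l ∈ F[j], X.idxOf l.1 < X.length ∧ α (X.idxOf l.1) = l.2)
    {u j : ℕ} (hu : u < s) (hj : j < F.length) : DerivStep A (axCl α X.length u j) := by
  obtain ⟨l, hl, hidx, hαl⟩ := hT j hj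
  refine DerivStep.of_mem (hA (ax19 X F s hu hj hl)) ?_
  rw [← hαl]
  intro x hx
  simp only [Finset.mem_insert, Finset.mem_singleton] at hx
  rcases hx with rfl | rfl | rfl
  · exact Finset.mem_insert_of_mem (negP_mem_trueCl α _ u)
  · exact Finset.mem_insert_self _ _
  · exact Finset.mem_insert_of_mem (posD_mem_trueCl α _ hidx)

/-- `True(u) ⊆ iCl … u k`. [folklore] -/
theorem trueCl_subset_iCl (m u k : ℕ) : trueCl α X.length u ⊆ iCl α X.length m u k :=
  fun _ hx => Finset.mem_insert_of_mem (Finset.mem_union_right _ hx)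

/-- `iCl … u 0` is a weakening of (A2). [cite: AtseriasMuller2020, proof of Lemma 11 ("Cut (A2)
with this")] -/
theorem derivStep_iCl_zero (hA : clauseSet (rref X F s) ⊆ A) {u : ℕ} (hu : u < s) :
    DerivStep A (iCl α X.length F.length u 0) := by
  refine DerivStep.of_mem (hA (ax2 X F s hu)) ?_
  intro x hx
  rw [List.mem_toFinset, List.mem_append] at hx
  rcases hx with hx | hx
  · simp only [pfx, if_true, List.mem_singleton] at hx
    subst hx
    exact trueCl_subset_iCl _ _ _ (negP_mem_trueCl α _ u)
  · obtain ⟨o, ho, rfl⟩ := List.mem_map.1 hx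
    simp only [optRange, List.mem_cons, List.mem_map, List.mem_range] at ho
    rcases ho with rfl | ⟨j, hj, rfl⟩
    · exact Finset.mem_insert_self _ _
    · exact Finset.mem_insert_of_mem (Finset.mem_union_left _
        (Finset.mem_image.2 ⟨j, Finset.mem_Ico.2 ⟨Nat.zero_le _, hj⟩, rfl⟩))

/-- `iCl … u (k+1)` from `iCl … u k` and `A₀(k,u)` by a cut on `I[u,k]`.
[cite: AtseriasMuller2020, proof of Lemma 11 ("then with A₀(j,u) for all j ∈ [m] in sequence")]
-/
theorem derivStep_iCl_succ {u k : ℕ} (hk : k < F.length)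
    (hD : iCl α X.length F.length u k ∈ A) (hE : axCl α X.length u k ∈ A) :
    DerivStep A (iCl α X.length F.length u (k + 1)) := by
  refine DerivStep.of_res hD hE (v := RefVar.I u (some k)) ?_ ?_ ?_ ?_
  · exact Finset.mem_insert_of_mem (Finset.mem_union_left _
      (Finset.mem_image.2 ⟨k, Finset.mem_Ico.2 ⟨le_rfl, hk⟩, rfl⟩))
  · exact Finset.mem_insert_self _ _
  · rw [← Finset.subset_insert_iff]
    refine Finset.insert_subset_iff.2 ⟨?_, Finset.union_subset ?_ ?_⟩
    · exact Finset.mem_insert_of_mem (Finset.mem_insert_self _ _)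
    · refine (image_Ico_subset_insert _ k F.length).trans (Finset.insert_subset_insert _ ?_)
      exact fun x hx => Finset.mem_insert_of_mem (Finset.mem_union_left _ hx)
    · exact (trueCl_subset_iCl _ _ _).trans (Finset.subset_insert _ _)
  · exact (Finset.erase_insert_subset _ _).trans (trueCl_subset_iCl _ _ _)

/-- The `A₀`-block of line `u` is a step list (from the axioms alone). [folklore] -/
theorem stepList_axBlock (hA : clauseSet (rref X F s) ⊆ A)
    (hT : ∀ j, ∀ hj : j < F.length, ∃ l ∈ F[j], X.idxOf l.1 < X.length ∧ α (X.idxOf l.1) = l.2)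
    {u : ℕ} (hu : u < s) : StepList A ((List.range F.length).map (axCl α X.length u)) :=
  stepList_map_range fun _ hj => (derivStep_axCl hA hT hu hj).mono Set.subset_union_left

/-- The `iCl`-chain of line `u` is a step list once the `A₀(j,u)` are available. [folklore] -/
theorem stepList_iChain (hA : clauseSet (rref X F s) ⊆ A) {u : ℕ} (hu : u < s)
    (hax : ∀ j < F.length, axCl α X.length u j ∈ A) :
    StepList A ((List.range (F.length + 1)).map (iCl α X.length F.length u)) := by
  refine stepList_map_range fun k hk => ?_
  rcases k with _ | k
  · exact (derivStep_iCl_zero hA hu).mono Set.subset_union_left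
  · have hk' : k < F.length := by omega
    exact derivStep_iCl_succ hk' (Or.inr ⟨k, Nat.lt_succ_self k, rfl⟩) (Or.inl (hax k hk'))

/-! ### The chain for a pivot index `i` and an earlier line `v` -/

/-- `True(u) ⊆ w2Cl … u i v k`. [folklore] -/
theorem trueCl_subset_w2Cl (u i v k : ℕ) : trueCl α X.length u ⊆ w2Cl α X.length u i v k :=
  fun _ hx => Finset.mem_insert_of_mem (Finset.mem_insert_of_mem (Finset.mem_insert_of_mem
    (Finset.mem_union_right _ hx)))

/-- `True(u) ⊆ w3Cl … u i v`. [folklore] -/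
theorem trueCl_subset_w3Cl (u i v : ℕ) : trueCl α X.length u ⊆ w3Cl α X.length u i v :=
  fun _ hx => Finset.mem_insert_of_mem (Finset.mem_insert_of_mem hx)

/-- `w1Cl`: the cut of (A15)/(A16) with (A20) on `D[v,i,1-α(X_i)]`, giving
`¬P[u] ∨ ¬P[v] ∨ ¬S[u,v] ∨ ¬V[u,i] ∨ ¬D[v,i,α(X_i)]`. [cite: AtseriasMuller2020, proof of Lemma 11
("Cut (A15) with P̄[v] ∨ D̄[v,i,0] ∨ D̄[v,i,1] of type (A20) on D[v,i,0]")] -/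
theorem derivStep_w1Cl (hA : clauseSet (rref X F s) ⊆ A) {u i v : ℕ} (hu : u < s) (hv : v < s)
    (hi : i < X.length) : DerivStep A (w1Cl α u i v) := by
  refine DerivStep.of_res (hA (ax1516 X F s (α i) hu hv hi)) (hA (ax20 X F s hv hi))
    (v := RefVar.D v i (!α i)) (by simp) (by cases α i <;> simp) ?_ ?_
  · rw [← Finset.subset_insert_iff]
    intro x hx
    simp only [Finset.mem_insert, Finset.mem_singleton] at hx
    rcases hx with rfl | rfl | rfl | rfl | rfl <;> simp [w1Cl]
  · rw [← Finset.subset_insert_iff]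
    intro x hx
    simp only [Finset.mem_insert, Finset.mem_singleton] at hx
    rcases hx with rfl | rfl | rfl
    · simp [w1Cl]
    · cases h : α i <;> simp [w1Cl, h]
    · cases h : α i <;> simp [w1Cl, h]

/-- `w2Cl … 0`: the cut of `True(v)` with `w1Cl` on `D[v,i,α(X_i)]`.
[cite: AtseriasMuller2020, proof of Lemma 11 ("Cut this with True(v) on D[v,i,α(X_i)]")] -/
theorem derivStep_w2Cl_zero {u i v : ℕ} (hi : i < X.length) (hD : trueCl α X.length v ∈ A)
    (hE : w1Cl α u i v ∈ A) : DerivStep A (w2Cl α X.length u i v 0) := by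
  refine DerivStep.of_res hD hE (v := RefVar.D v i (α i)) (posD_mem_trueCl α _ hi)
    (by simp [w1Cl]) ?_ ?_
  · rw [← Finset.subset_insert_iff]
    refine Finset.insert_subset_iff.2 ⟨by simp [w2Cl], fun x hx => ?_⟩
    obtain ⟨i', hi', rfl⟩ := Finset.mem_image.1 hx
    rw [Finset.mem_range] at hi'
    by_cases h : i' = i
    · subst h; exact Finset.mem_insert_self _ _
    · refine Finset.mem_insert_of_mem (Finset.mem_insert_of_mem (Finset.mem_insert_of_mem
        (Finset.mem_insert_of_mem (Finset.mem_union_left _ ?_))))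
      exact Finset.mem_image.2 ⟨i', Finset.mem_filter.2 ⟨Finset.mem_Ico.2 ⟨Nat.zero_le _, hi'⟩, h⟩,
        rfl⟩
  · rw [← Finset.subset_insert_iff]
    intro x hx
    simp only [w1Cl, Finset.mem_insert, Finset.mem_singleton] at hx
    rcases hx with rfl | rfl | rfl | rfl | rfl
    · exact Finset.mem_insert_of_mem (trueCl_subset_w2Cl _ _ _ _ (negP_mem_trueCl α _ u))
    · simp [w2Cl]
    · simp [w2Cl]
    · simp [w2Cl]
    · exact Finset.mem_insert_self _ _

/-- `w2Cl … (k+1)` from `w2Cl … k`: for `k ≠ i` the cut with (A17)/(A18) on `D[v,k,α(X_k)]`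
(moving the literal to line `u`), for `k = i` a mere weakening.
[cite: AtseriasMuller2020, proof of Lemma 11 ("Cut this with (A17) on D[v,i',α(X_{i'})] for every
i' ∈ [n] ∖ {i}")] -/
theorem derivStep_w2Cl_succ (hA : clauseSet (rref X F s) ⊆ A) {u i v k : ℕ} (hu : u < s)
    (hv : v < s) (hi : i < X.length) (hk : k < X.length) (hD : w2Cl α X.length u i v k ∈ A) :
    DerivStep A (w2Cl α X.length u i v (k + 1)) := by
  by_cases hki : k = i
  · refine DerivStep.of_mem hD (Finset.insert_subset_insert _ (Finset.insert_subset_insert _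
      (Finset.insert_subset_insert _ (Finset.union_subset_union ?_ subset_rfl))))
    intro x hx
    obtain ⟨i', hi', rfl⟩ := Finset.mem_image.1 hx
    rw [Finset.mem_filter, Finset.mem_Ico] at hi'
    exact Finset.mem_image.2
      ⟨i', Finset.mem_filter.2 ⟨Finset.mem_Ico.2 ⟨by omega, hi'.1.2⟩, hi'.2⟩, rfl⟩
  · refine DerivStep.of_res hD (hA (ax1718 X F s (α i) hu hv hi hk hki (α k)))
      (v := RefVar.D v k (α k)) ?_ (by simp) ?_ ?_
    · refine Finset.mem_insert_of_mem (Finset.mem_insert_of_mem (Finset.mem_insert_of_mem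
        (Finset.mem_union_left _ ?_)))
      exact Finset.mem_image.2 ⟨k, Finset.mem_filter.2 ⟨Finset.mem_Ico.2 ⟨le_rfl, hk⟩, hki⟩, rfl⟩
    · rw [← Finset.subset_insert_iff]
      refine Finset.insert_subset_iff.2 ⟨by simp [w2Cl], Finset.insert_subset_iff.2
        ⟨by simp [w2Cl], Finset.insert_subset_iff.2 ⟨by simp [w2Cl], Finset.union_subset ?_ ?_⟩⟩⟩
      · refine (image_filter_Ico_subset_insert _ k X.length i).trans
          (Finset.insert_subset_insert _ fun x hx => ?_)
        exact Finset.mem_insert_of_mem (Finset.mem_insert_of_mem (Finset.mem_insert_of_mem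
          (Finset.mem_union_left _ hx)))
      · exact (trueCl_subset_w2Cl _ _ _ _).trans (Finset.subset_insert _ _)
    · rw [← Finset.subset_insert_iff]
      intro x hx
      simp only [Finset.mem_insert, Finset.mem_singleton] at hx
      rcases hx with rfl | rfl | rfl | rfl | rfl | rfl
      · exact Finset.mem_insert_of_mem (trueCl_subset_w2Cl _ _ _ _ (negP_mem_trueCl α _ u))
      · simp [w2Cl]
      · simp [w2Cl]
      · simp [w2Cl]
      · exact Finset.mem_insert_self _ _
      · exact Finset.mem_insert_of_mem (trueCl_subset_w2Cl _ _ _ _ (posD_mem_trueCl α _ hk))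

/-- `w3Cl`: the cut of (A22)/(A23) with `w2Cl … n` on `P[v]`, giving
`¬S[u,v] ∨ ¬V[u,i] ∨ True(u)` (the paper's display (13), weakened by `True(u)`).
[cite: AtseriasMuller2020, proof of Lemma 11 ("and then with (A22) on P[v] to get (13)")] -/
theorem derivStep_w3Cl (hA : clauseSet (rref X F s) ⊆ A) {u i v : ℕ} (hu : u < s) (hv : v < s)
    (hE : w2Cl α X.length u i v X.length ∈ A) : DerivStep A (w3Cl α X.length u i v) := by
  refine DerivStep.of_res (hA (ax2223 X F s (α i) hu hv)) hE (v := RefVar.P v) (by simp)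
    (by simp [w2Cl]) ?_ ?_
  · rw [← Finset.subset_insert_iff]
    intro x hx
    simp only [Finset.mem_insert, Finset.mem_singleton] at hx
    rcases hx with rfl | rfl | rfl
    · exact Finset.mem_insert_of_mem (trueCl_subset_w3Cl _ _ _ (negP_mem_trueCl α _ u))
    · simp [w3Cl]
    · exact Finset.mem_insert_self _ _
  · rw [← Finset.subset_insert_iff]
    refine Finset.insert_subset_iff.2 ⟨Finset.mem_insert_self _ _, Finset.insert_subset_iff.2
      ⟨by simp [w3Cl], Finset.insert_subset_iff.2 ⟨by simp [w3Cl], Finset.union_subset ?_ ?_⟩⟩⟩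
    · intro x hx
      obtain ⟨i', hi', rfl⟩ := Finset.mem_image.1 hx
      rw [Finset.mem_filter, Finset.mem_Ico] at hi'
      omega
    · exact (trueCl_subset_w3Cl _ _ _).trans (Finset.subset_insert _ _)

/-- The chain `wChunk … u i v` is a step list once `True(v)` is available (`n + 2` cuts).
[cite: AtseriasMuller2020, proof of Lemma 11 ("the clause (13) is derived with n+2 cuts")] -/
theorem stepList_wChunk (hA : clauseSet (rref X F s) ⊆ A) {u i v : ℕ} (hu : u < s) (hvu : v < u)
    (hi : i < X.length) (hTv : trueCl α X.length v ∈ A) :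
    StepList A (wChunk α X.length u i v) := by
  have hv : v < s := hvu.trans hu
  refine ⟨derivStep_w1Cl hA hu hv hi, StepList.append (stepList_map_range fun k hk => ?_) ?_⟩
  · rcases k with _ | k
    · exact derivStep_w2Cl_zero hi (Or.inl (Set.mem_insert_of_mem _ hTv))
        (Or.inl (Set.mem_insert _ _))
    · exact derivStep_w2Cl_succ
        (hA.trans ((Set.subset_insert _ _).trans Set.subset_union_left)) hu hv hi (by omega)
        (Or.inr ⟨k, Nat.lt_succ_self k, rfl⟩)
  · refine stepList_singleton (derivStep_w3Cl
      (hA.trans ((Set.subset_insert _ _).trans Set.subset_union_left)) hu hv (Or.inr ?_))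
    exact List.mem_map.2 ⟨X.length, List.mem_range.2 (Nat.lt_succ_self _), rfl⟩

/-! ### The `sCl`-chain and `vcCl` -/

/-- `True(u) ⊆ sCl … u i k`. [folklore] -/
theorem trueCl_subset_sCl (u i k : ℕ) : trueCl α X.length u ⊆ sCl α X.length s u i k :=
  fun _ hx => Finset.mem_insert_of_mem (Finset.mem_insert_of_mem (Finset.mem_union_right _ hx))

/-- `sCl … 0` is a weakening of (A3)/(A4). [cite: AtseriasMuller2020, proof of Lemma 11 ("Now
cut (A3) with …")] -/
theorem derivStep_sCl_zero (hA : clauseSet (rref X F s) ⊆ A) {u i : ℕ} (hu : u < s) :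
    DerivStep A (sCl α X.length s u i 0) := by
  refine DerivStep.of_mem (hA (ax34 X F s (α i) hu)) ?_
  intro x hx
  rw [List.mem_toFinset, List.mem_append] at hx
  rcases hx with hx | hx
  · simp only [pfx, if_true, List.mem_singleton] at hx
    subst hx
    exact trueCl_subset_sCl _ _ _ (negP_mem_trueCl α _ u)
  · obtain ⟨o, ho, rfl⟩ := List.mem_map.1 hx
    simp only [optRange, List.mem_cons, List.mem_map, List.mem_range] at ho
    rcases ho with rfl | ⟨v, hv, rfl⟩
    · exact Finset.mem_insert_of_mem (Finset.mem_insert_self _ _)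
    · exact Finset.mem_insert_of_mem (Finset.mem_insert_of_mem (Finset.mem_union_left _
        (Finset.mem_image.2 ⟨v, Finset.mem_Ico.2 ⟨Nat.zero_le _, hv⟩, rfl⟩)))

/-- `sCl … (k+1)` from `sCl … k` by a cut on `S[u,k]`: with `w3Cl … k` if `k < u`, with
(A13)/(A14) if `u ≤ k`. [cite: AtseriasMuller2020, proof of Lemma 11 ("cut (A3) with this formula
for all v ∈ [u-1], and with (A13) for all u ≤ v ≤ s")] -/
theorem derivStep_sCl_succ (hA : clauseSet (rref X F s) ⊆ A) {u i k : ℕ} (hk : k < s)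
    (hD : sCl α X.length s u i k ∈ A) (hW : k < u → w3Cl α X.length u i k ∈ A) :
    DerivStep A (sCl α X.length s u i (k + 1)) := by
  have hDsub : sCl α X.length s u i k ⊆
      insert (side (α i) u (some k), true) (sCl α X.length s u i (k + 1)) := by
    refine Finset.insert_subset_iff.2 ⟨by simp [sCl], Finset.insert_subset_iff.2
      ⟨by simp [sCl], Finset.union_subset ?_ ?_⟩⟩
    · refine (image_Ico_subset_insert _ k s).trans (Finset.insert_subset_insert _ fun x hx => ?_)
      exact Finset.mem_insert_of_mem (Finset.mem_insert_of_mem (Finset.mem_union_left _ hx))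
    · exact (trueCl_subset_sCl _ _ _).trans (Finset.subset_insert _ _)
  have hpiv : (side (α i) u (some k), true) ∈ sCl α X.length s u i k :=
    Finset.mem_insert_of_mem (Finset.mem_insert_of_mem (Finset.mem_union_left _
      (Finset.mem_image.2 ⟨k, Finset.mem_Ico.2 ⟨le_rfl, hk⟩, rfl⟩)))
  by_cases hku : k < u
  · refine DerivStep.of_res hD (hW hku) (v := side (α i) u (some k)) hpiv
      (Finset.mem_insert_self _ _) (Finset.subset_insert_iff.1 hDsub) ?_
    exact (Finset.erase_insert_subset _ _).trans
      (Finset.insert_subset_iff.2 ⟨Finset.mem_insert_self _ _, trueCl_subset_sCl _ _ _⟩)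
  · refine DerivStep.of_res hD (hA (ax1314 X F s (α i) (not_lt.1 hku) hk))
      (v := side (α i) u (some k)) hpiv (by simp) (Finset.subset_insert_iff.1 hDsub) ?_
    rw [← Finset.subset_insert_iff]
    intro x hx
    simp only [Finset.mem_insert, Finset.mem_singleton] at hx
    rcases hx with rfl | rfl
    · exact Finset.mem_insert_of_mem (trueCl_subset_sCl _ _ _ (negP_mem_trueCl α _ u))
    · exact Finset.mem_insert_self _ _

/-- `True(u) ⊆ vcCl … u i`. [folklore] -/
theorem trueCl_subset_vcCl (u i : ℕ) : trueCl α X.length u ⊆ vcCl α X.length u i :=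
  fun _ hx => Finset.mem_insert_of_mem (Finset.mem_insert_of_mem hx)

/-- `vcCl`: the cut of `sCl … s` with (A11)/(A12) on `S[u,0]`, giving `¬V[u,i] ∨ ¬I[u,0] ∨ True(u)`.
[cite: AtseriasMuller2020, proof of Lemma 11 ("then with (A11) on L[u,0]")] -/
theorem derivStep_vcCl (hA : clauseSet (rref X F s) ⊆ A) {u i : ℕ} (hu : u < s)
    (hD : sCl α X.length s u i s ∈ A) : DerivStep A (vcCl α X.length u i) := by
  refine DerivStep.of_res hD (hA (ax1112 X F s (α i) hu)) (v := side (α i) u none)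
    (Finset.mem_insert_of_mem (Finset.mem_insert_self _ _)) (by simp) ?_ ?_
  · rw [← Finset.subset_insert_iff]
    refine Finset.insert_subset_iff.2 ⟨by simp [vcCl], Finset.insert_subset_iff.2
      ⟨Finset.mem_insert_self _ _, Finset.union_subset ?_ ?_⟩⟩
    · intro x hx
      obtain ⟨v, hv, rfl⟩ := Finset.mem_image.1 hx
      rw [Finset.mem_Ico] at hv
      omega
    · exact (trueCl_subset_vcCl _ _).trans (Finset.subset_insert _ _)
  · rw [← Finset.subset_insert_iff]
    intro x hx
    simp only [Finset.mem_insert, Finset.mem_singleton] at hx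
    rcases hx with rfl | rfl | rfl
    · exact Finset.mem_insert_of_mem (trueCl_subset_vcCl _ _ (negP_mem_trueCl α _ u))
    · simp [vcCl]
    · exact Finset.mem_insert_self _ _

/-- The block `iBlock … u i` is a step list once `True(v)` is available for all `v < u`.
[cite: AtseriasMuller2020, proof of Lemma 11 ("A₁(i,u) is derived with (n+2)(u-1)+s many cuts")]
-/
theorem stepList_iBlock (hA : clauseSet (rref X F s) ⊆ A) {u i : ℕ} (hu : u < s)
    (hi : i < X.length) (hT : ∀ v < u, trueCl α X.length v ∈ A) :
    StepList A (iBlock α X.length s u i) := by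
  unfold iBlock
  refine StepList.append (stepList_flatMap_range fun v hv =>
    stepList_wChunk (hA.trans Set.subset_union_left) hu hv hi (Or.inl (hT v hv))) ?_
  have hA₁ : clauseSet (rref X F s) ⊆
      A ∪ {C | C ∈ (List.range u).flatMap (wChunk α X.length u i)} :=
    hA.trans Set.subset_union_left
  refine StepList.append (stepList_map_range fun k hk => ?_) (stepList_singleton ?_)
  · rcases k with _ | k
    · exact (derivStep_sCl_zero hA₁ hu).mono Set.subset_union_left
    · refine derivStep_sCl_succ (hA₁.trans Set.subset_union_left) (by omega)
        (Or.inr ⟨k, Nat.lt_succ_self k, rfl⟩) fun hku => Or.inl (Or.inr ?_)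
      exact List.mem_flatMap.2 ⟨k, List.mem_range.2 hku, by simp [wChunk]⟩
  · refine derivStep_vcCl (hA₁.trans Set.subset_union_left) hu (Or.inr ?_)
    exact List.mem_map.2 ⟨s, List.mem_range.2 (Nat.lt_succ_self s), rfl⟩

/-! ### The `vCl`-chain, `finCl` and `True(u)` -/

/-- `True(u) ⊆ vCl … u k`. [folklore] -/
theorem trueCl_subset_vCl (u k : ℕ) : trueCl α X.length u ⊆ vCl α X.length u k :=
  fun _ hx => Finset.mem_insert_of_mem (Finset.mem_insert_of_mem (Finset.mem_union_right _ hx))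

/-- `vCl … u 0` is a weakening of (A1). [cite: AtseriasMuller2020, proof of Lemma 11 ("cut (A1)
with A₁(i,u) for all i ∈ [n]")] -/
theorem derivStep_vCl_zero (hA : clauseSet (rref X F s) ⊆ A) {u : ℕ} (hu : u < s) :
    DerivStep A (vCl α X.length u 0) := by
  refine DerivStep.of_mem (hA (ax1 X F s hu)) ?_
  intro x hx
  rw [List.mem_toFinset, List.mem_append] at hx
  rcases hx with hx | hx
  · simp only [pfx, if_true, List.mem_singleton] at hx
    subst hx
    exact trueCl_subset_vCl _ _ (negP_mem_trueCl α _ u)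
  · obtain ⟨o, ho, rfl⟩ := List.mem_map.1 hx
    simp only [optRange, List.mem_cons, List.mem_map, List.mem_range] at ho
    rcases ho with rfl | ⟨i, hi, rfl⟩
    · exact Finset.mem_insert_of_mem (Finset.mem_insert_self _ _)
    · exact Finset.mem_insert_of_mem (Finset.mem_insert_of_mem (Finset.mem_union_left _
        (Finset.mem_image.2 ⟨i, Finset.mem_Ico.2 ⟨Nat.zero_le _, hi⟩, rfl⟩)))

/-- `vCl … u (k+1)` from `vCl … u k` and `vcCl … u k` by a cut on `V[u,k]`.
[cite: AtseriasMuller2020, proof of Lemma 11 ("In a sequence of n many cuts, cut (A1) with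
A₁(i,u) for all i ∈ [n]")] -/
theorem derivStep_vCl_succ {u k : ℕ} (hk : k < X.length) (hD : vCl α X.length u k ∈ A)
    (hE : vcCl α X.length u k ∈ A) : DerivStep A (vCl α X.length u (k + 1)) := by
  refine DerivStep.of_res hD hE (v := RefVar.V u (some k)) ?_ (Finset.mem_insert_self _ _) ?_ ?_
  · exact Finset.mem_insert_of_mem (Finset.mem_insert_of_mem (Finset.mem_union_left _
      (Finset.mem_image.2 ⟨k, Finset.mem_Ico.2 ⟨le_rfl, hk⟩, rfl⟩)))
  · rw [← Finset.subset_insert_iff]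
    refine Finset.insert_subset_iff.2 ⟨by simp [vCl], Finset.insert_subset_iff.2
      ⟨by simp [vCl], Finset.union_subset ?_ ?_⟩⟩
    · refine (image_Ico_subset_insert _ k X.length).trans
        (Finset.insert_subset_insert _ fun x hx => ?_)
      exact Finset.mem_insert_of_mem (Finset.mem_insert_of_mem (Finset.mem_union_left _ hx))
    · exact (trueCl_subset_vCl _ _).trans (Finset.subset_insert _ _)
  · exact (Finset.erase_insert_subset _ _).trans
      (Finset.insert_subset_iff.2 ⟨Finset.mem_insert_self _ _, trueCl_subset_vCl _ _⟩)

/-- `finCl`: the cut of `vCl … u n` with (A9) on `V[u,0]`, giving `¬I[u,0] ∨ True(u)`.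
[cite: AtseriasMuller2020, proof of Lemma 11 ("Cut with (A9) on V[u,0]")] -/
theorem derivStep_finCl (hA : clauseSet (rref X F s) ⊆ A) {u : ℕ} (hu : u < s)
    (hD : vCl α X.length u X.length ∈ A) : DerivStep A (finCl α X.length u) := by
  refine DerivStep.of_res hD (hA (ax9 X F s hu)) (v := RefVar.V u none)
    (Finset.mem_insert_of_mem (Finset.mem_insert_self _ _)) (by simp) ?_ ?_
  · rw [← Finset.subset_insert_iff]
    refine Finset.insert_subset_iff.2 ⟨by simp [finCl], Finset.insert_subset_iff.2
      ⟨Finset.mem_insert_self _ _, Finset.union_subset ?_ ?_⟩⟩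
    · intro x hx
      obtain ⟨i, hi, rfl⟩ := Finset.mem_image.1 hx
      rw [Finset.mem_Ico] at hi
      omega
    · exact fun x hx => Finset.mem_insert_of_mem (Finset.mem_insert_of_mem hx)
  · rw [← Finset.subset_insert_iff]
    intro x hx
    simp only [Finset.mem_insert, Finset.mem_singleton] at hx
    rcases hx with rfl | rfl | rfl
    · exact Finset.mem_insert_of_mem (Finset.mem_insert_of_mem (negP_mem_trueCl α _ u))
    · simp [finCl]
    · exact Finset.mem_insert_self _ _

/-- `True(u)`: the cut of `iCl … u m = I[u,0] ∨ True(u)` with `finCl = ¬I[u,0] ∨ True(u)` on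
`I[u,0]`. [cite: AtseriasMuller2020, proof of Lemma 11 ("Cut (A2) with this and then with A₀(j,u)
for all j ∈ [m] in sequence to get True(u) as desired")] -/
theorem derivStep_trueCl {u : ℕ} (hD : iCl α X.length F.length u F.length ∈ A)
    (hE : finCl α X.length u ∈ A) : DerivStep A (trueCl α X.length u) := by
  refine DerivStep.of_res hD hE (v := RefVar.I u none) (Finset.mem_insert_self _ _)
    (Finset.mem_insert_self _ _) ?_ (Finset.erase_insert_subset _ _)
  rw [← Finset.subset_insert_iff]
  refine Finset.insert_subset_iff.2 ⟨Finset.mem_insert_self _ _, Finset.union_subset ?_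
    (Finset.subset_insert _ _)⟩
  intro x hx
  obtain ⟨j, hj, rfl⟩ := Finset.mem_image.1 hx
  rw [Finset.mem_Ico] at hj
  omega

/-- **The block of line `u` is a step list** once `True(v)` is available for all `v < u`; its
last clause is `True(u)`. [cite: AtseriasMuller2020, proof of Lemma 11 (derivation of True(u)
from True(v), v < u)] -/
theorem stepList_lineBlock (hA : clauseSet (rref X F s) ⊆ A)
    (hT : ∀ j, ∀ hj : j < F.length, ∃ l ∈ F[j], X.idxOf l.1 < X.length ∧ α (X.idxOf l.1) = l.2)
    {u : ℕ} (hu : u < s) (hTv : ∀ v < u, trueCl α X.length v ∈ A) :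
    StepList A (lineBlock α X.length F.length s u) := by
  unfold lineBlock
  refine StepList.append (StepList.append (StepList.append (stepList_axBlock hA hT hu) ?_) ?_) ?_
  · -- the `iCl`-chain, using the `A₀(j,u)`
    exact stepList_iChain (hA.trans Set.subset_union_left) hu
      fun j hj => Or.inr (List.mem_map.2 ⟨j, List.mem_range.2 hj, rfl⟩)
  · -- the blocks for the pivot indices, using `True(v)` for `v < u`
    exact stepList_flatMap_range fun i hi => stepList_iBlock
      ((hA.trans Set.subset_union_left).trans Set.subset_union_left) hu hi
      fun v hv => Or.inl (Or.inl (hTv v hv))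
  · -- the `vCl`-chain, `finCl`, `True(u)`
    have hA₃ : clauseSet (rref X F s) ⊆ A ∪ {C | C ∈
        (List.range F.length).map (axCl α X.length u) ++
          (List.range (F.length + 1)).map (iCl α X.length F.length u) ++
            (List.range X.length).flatMap (iBlock α X.length s u)} :=
      hA.trans Set.subset_union_left
    refine StepList.append (stepList_map_range fun k hk => ?_) ⟨?_, ?_, trivial⟩
    · rcases k with _ | k
      · exact (derivStep_vCl_zero hA₃ hu).mono Set.subset_union_left
      · refine derivStep_vCl_succ (by omega) (Or.inr ⟨k, Nat.lt_succ_self k, rfl⟩)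
          (Or.inl (Or.inr (List.mem_append.2 (Or.inr ?_))))
        exact List.mem_flatMap.2 ⟨k, List.mem_range.2 (by omega), by simp [iBlock]⟩
    · refine derivStep_finCl (hA₃.trans Set.subset_union_left) hu (Or.inr ?_)
      exact List.mem_map.2 ⟨X.length, List.mem_range.2 (Nat.lt_succ_self _), rfl⟩
    · refine derivStep_trueCl (F := F) ?_ (Or.inl rfl)
      refine Or.inr (Or.inl (Or.inr (List.mem_append.2 (Or.inl (List.mem_append.2 (Or.inr ?_))))))
      exact List.mem_map.2 ⟨F.length, List.mem_range.2 (Nat.lt_succ_self _), rfl⟩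

/-! ### The final block -/

/-- `eCl t 0` is (a weakening of) `True(t)`. [folklore] -/
theorem derivStep_eCl_zero {t : ℕ} (hD : trueCl α X.length t ∈ A) :
    DerivStep A (eCl α X.length t 0) := by
  refine DerivStep.of_mem hD (Finset.insert_subset_insert _ fun x hx => ?_)
  obtain ⟨i, hi, rfl⟩ := Finset.mem_image.1 hx
  exact Finset.mem_image.2 ⟨i, Finset.mem_Ico.2 ⟨Nat.zero_le _, Finset.mem_range.1 hi⟩, rfl⟩

/-- `eCl t (k+1)` from `eCl t k` and (A21) by a cut on `D[t,k,α(X_k)]`.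
[cite: AtseriasMuller2020, proof of Lemma 11 ("n many cuts with (A21)")] -/
theorem derivStep_eCl_succ (hA : clauseSet (rref X F s) ⊆ A) {t k : ℕ} (ht : t + 1 = s)
    (hk : k < X.length) (hD : eCl α X.length t k ∈ A) : DerivStep A (eCl α X.length t (k + 1)) := by
  refine DerivStep.of_res hD (hA (ax21 X F s ht hk (α k))) (v := RefVar.D t k (α k))
    (Finset.mem_insert_of_mem (Finset.mem_image.2 ⟨k, Finset.mem_Ico.2 ⟨le_rfl, hk⟩, rfl⟩))
    (by simp) ?_ ?_
  · rw [← Finset.subset_insert_iff]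
    refine Finset.insert_subset_iff.2 ⟨by simp [eCl], ?_⟩
    exact (image_Ico_subset_insert _ k X.length).trans
      (Finset.insert_subset_insert _ fun x hx => Finset.mem_insert_of_mem hx)
  · rw [← Finset.subset_insert_iff]
    intro x hx
    simp only [Finset.mem_insert, Finset.mem_singleton] at hx
    rcases hx with rfl | rfl
    · simp [eCl]
    · exact Finset.mem_insert_self _ _

/-- The empty clause from (A24) `= P[t]` and `eCl t n = ¬P[t]`.
[cite: AtseriasMuller2020, proof of Lemma 11 ("and one cut with (A24) yield the empty clause")] -/
theorem derivStep_empty (hA : clauseSet (rref X F s) ⊆ A) {t : ℕ} (ht : t + 1 = s)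
    (hE : eCl α X.length t X.length ∈ A) : DerivStep A ∅ := by
  refine DerivStep.of_res (hA (ax24 X F s ht)) hE (v := RefVar.P t) (Finset.mem_singleton_self _)
    (Finset.mem_insert_self _ _) (by simp) ?_
  rw [← Finset.subset_insert_iff]
  refine Finset.insert_subset_iff.2 ⟨Finset.mem_insert_self _ _, fun x hx => ?_⟩
  obtain ⟨i, hi, rfl⟩ := Finset.mem_image.1 hx
  rw [Finset.mem_Ico] at hi
  omega

/-- **The final block is a step list** once `True(t)` is available, `t` the last line.
[cite: AtseriasMuller2020, proof of Lemma 11 ("Then n many cuts with (A21) and one cut with (A24)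
yield the empty clause")] -/
theorem stepList_lastBlock (hA : clauseSet (rref X F s) ⊆ A) {t : ℕ} (ht : t + 1 = s)
    (hTt : trueCl α X.length t ∈ A) : StepList A (lastBlock α X.length t) := by
  unfold lastBlock
  refine StepList.append (stepList_map_range fun k hk => ?_) (stepList_singleton ?_)
  · rcases k with _ | k
    · exact (derivStep_eCl_zero hTt).mono Set.subset_union_left
    · exact derivStep_eCl_succ (hA.trans Set.subset_union_left) ht (by omega)
        (Or.inr ⟨k, Nat.lt_succ_self k, rfl⟩)
  · refine derivStep_empty (α := α) (hA.trans Set.subset_union_left) ht (Or.inr ?_)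
    exact List.mem_map.2 ⟨X.length, List.mem_range.2 (Nat.lt_succ_self _), rfl⟩

end Pudlak

end RefCNF

end Literature.Computability.MetaComplexity
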